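import Summits.QuantumFields.BalabanUV.T4Continuum.Support.NE7SliceGreenPairingLocalised
import HarnessLib

/-!
# NE7SliceGreenFlatLocalised — THE LOCALISED SLICE SOLVER LETTER G♭-loc ON THE T4 SIDE (the `hGloc` binder of F252 `NE7ApeFlatSkeletonLocalised`, DISCHARGED):
# there are `K ≥ 0`, `c > 0` (on `d`, `L`, `card n` only) such that for every `k`, `N`, every skew `(L^{k+1}N)`-periodic flat-tangent `X`, every centre block `y₀`,
# radius `ℓ`, near set `Bn ⊆ [0,L^{k+1}N)^{d+1}` and far set `Bf` (sites whose block is at torus block-distance `≥ ℓ + nbRad + 1` from `y₀`), and every `a, b ≥ 0` with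
# `|hess 1 X Y| ≤ a‖Y‖_{1,Bn} + b‖Y‖_{1,Bf}` on skew periodic flat tangents `Y`: `‖curlAt 1 X z μ ν‖ ≤ K·L^{k+1}·(a + e^{−cℓ}·b)` at every `z` of the block `y₀`

Cell `pub-balaban`, rung (B)+1 sub-cell t4, lineage `b2b-balaban-t4-ne7-p1` (CRUX PROVER NE7 #1 = OWNER of row NE7), generation 89; memo
`t4/b2b-balaban-t4-ne7-p1-g89/COSTING-N1.md` §3, §5 (1).  File F254d — the END of the localised G♭ (§1 = F254c `NE7SliceGreenPairingLocalised`) (over F253b `NE7SliceGreenTorusLocalised.exists_sliceGreen_localised_const`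
(torus core: GAN24's (1.110) decay + `H_k` decay), F254a `NE7TangentCorrectorLocal.exists_tangent_of_straight_zero_local`, F254b `NE7CornerCostFar`
(`corner_cost_far_le`, `rep_blockOf_toT`), and G3∕G3a BY NAME: `NE7SliceGreenFlat.exists_kerQ_entry`, `NE7SliceGreenTestField` (test directions, `hess_flat_test`,
`curl_pairing_eq`, `norm_test_le`), `NE7TorusBoxDictionary.curlAt_flat_entry_torus`, `NE7FlatHkCurlLetter.opNorm_le_card_mul`).

WHY (torus road v2).  F252 re-typed the flat bootstrap of the torus road with TWO-REGION source densities and the solver letter LOCALISED at the plaquette, so that the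
cutoff's shell terms are discounted by `ϵ ≍ e^{−cR}` and a local chart of PRINT's quality ([B8] Thm 2 at `U₀ = 1`, constants ∝ the cube size) suffices (memo §2–§3).
F253a∕b proved the torus-side letter; THIS FILE is its T4 reading in exactly F252's binder shape: G3's chain (entry ↦ `ker Q_k` representative ↦ curl pairing against the
test directions `Y^{a}` ↦ the T4 hypothesis on the tangent-corrected test direction) with the corrector's cost kept LOCAL (F254a∕b: far test fields pay far mass, up to
`nbRad + 1` blocks of margin), so that the far density `b` reaches the torus as a density on the far bond set and F253b's `e^{−cℓ}` survives.
WHAT ([folklore] composition; 0 def, 0 sorry; dimension `d + 1 ≥ 2`, `L ≥ 2`).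
§1 **`norm_curl_pairing_le_localised`** (G3 §3, two-region: `|⟨∂a,∂x̃⟩| ≤ g_a Σ|a| + g_b Σ_{far}|a|`, `g_a = 4M²(card n)²C₄·a`, `g_b = 4M²(card n)²C₄·b`, `C₄ = 1 + 4(d+1)²L`);
§2 **`sliceGreen_flat_localised`** — THE END (statement in the title; `K = 4(card n)³C₄(K_a + K_b)`, `c` = F253b's).
HONEST FRAMING (page 1): a composition of tree theorems at `U = 1`; the constants are existential functions of `d, L, card n`; nothing printed is asserted ([B5] (1.110)∕(1.115),
[B11] (161)∕(163) are TEXT LOCATIONS); with this file the torus road v2 END (F252) has G♭-loc IN KERNEL — its remaining hypotheses are the chart (N1)-weak ([B8] Thm 2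
TYPE at `U₀ = 1`, local), the defect assembly (N2), the coarse-curl bound (N3)′ and (R7♭)-loc; NOT (APE), NOT ONE-STEP, NOT NE7; spine 0∕9; finite T⁴ rung (B)+1 — NOT
infinite volume, NOT mass gap, NOT `BetaPertH`, NOT Clay.  Continuum YM on T⁴ ⇐ BetaPertH ∧ nine spine estimates (0/9 proved); BetaPertH ⇐ (D1) ∧ (D4) ∧ CAP+tail;
G-an2-4 gates asym, D1 and NE2/3/4.
-/

set_option autoImplicit false

open scoped BigOperators Matrix ComplexConjugate Matrix.Norms.L2Operator
open Finset

namespace Summit.QuantumFields.BalabanUV.T4Continuum.NE7SliceGreenFlatLocalised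

open Literature.MathematicalPhysics.QuantumFieldTheory.Balaban1983to89
open B7Prop1Explicit (Site e e_apply)
open T4AveragingDeficitWall (curlAt curl IsSkewDir SmallField dirL1)
open T4AveragingDeficitWallBoundary (periodBox mem_periodBox)
open AveragingDeficitPeriodicCounting (IsPeriodicDir)
open BlockAverageVaryHolo (nbRad)
open B5Prop11Plancherel (Tor fine unitVec)
open B5Action121 (Fs Fs_apply CurlOp CurlOp_mulVec)
open B5Block118 (QvOp bpt)
open B5Blocks16 (blockOf blockOf_bpt)
open B6LowerBound2153Torus (toT rep toT_rep sum_pbox_toT)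
open B4TorusKernel.MultiPeriod (torusSupNorm torusSupNorm_nonneg)
open BlockAveragePushDirSplit (flat)
open NE3TangentFlatStructure (framePot)
open NE3TangentCovariantTower (dirIter)
open NE3FlatHessianCurl (smallField_flatCfg_zero)
open NE3TangentFlatPush (flatCfg_eq_flat)
open NE3HessForm (hess)
open MinimalActionLevels (perWin)
open NE7ApeFlatSkeleton (hess_flat)
open NE7FlatHkOrthogonal (Fs_eq_mul_Fs_one)
open NE7FlatHkCurlLetter (opNorm_le_card_mul)
open NE7TorusBoxDictionary (curlAt_flat_entry_torus sum_periodBox_toT periodBox_eq_pbox)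
open NE7SliceGreenFlat (exists_kerQ_entry)
open NE7SliceGreenTestField (Fs_one_smul isSkewDir_test isPeriodicDir_test norm_test_le Qcoarse_iterate_test_eq_zero hess_flat_test curl_pairing_eq)
open NE7TangentCorrectorLocal (exists_tangent_of_straight_zero_local)
open NE7CornerCostFar (corner_cost_far_le rep_blockOf_toT)
open NE7SliceGreenTorusLocalised (exists_sliceGreen_localised_const)
open Beta.FluctuationProjection (digitOf bpt_blockOf_digitOf)

noncomputable section

variable {d : ℕ} {n : Type*} [Fintype n] [DecidableEq n]

open NE7SliceGreenPairingLocalised (abs_re_pairing_le_localised)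

/-! ## §1 The curl pairing of the `ker Q_k` representative, two-region -/

/-- **`|⟨∂_n a, ∂_n x̃⟩| ≤ 4n²(card n)²C₄·(a·‖a‖₁ + b·‖a|_{far}‖₁)`** for every `a ∈ ker Q_k`, whenever `x̃` has the plaquette field of the entry `x_{ii′}` of a skew periodic `X`
whose Hessian source is two-region bounded (G3 §3 with §1 at `c = 1, I`). [folklore] -/
theorem norm_curl_pairing_le_localised [Nonempty n] (hd : 1 ≤ d) {L : ℕ} (hL : 2 ≤ L) (k N : ℕ) [NeZero N] [NeZero (L ^ (k + 1))] [NeZero (L ^ (k + 1) * N)]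
    {X : Site (d + 1) → Fin (d + 1) → Matrix n n ℂ} (hXs : IsSkewDir X) (hXP : IsPeriodicDir X ((L ^ (k + 1) * N : ℕ) : ℤ))
    (cS : Site (d + 1)) (ℓ : ℝ) (Bn Bf : Finset (Site (d + 1))) (hBn : Bn ⊆ periodBox (d := d + 1) (L ^ (k + 1) * N))
    (hBf : Bf ⊆ periodBox (d := d + 1) (L ^ (k + 1) * N))
    (hfar : ∀ x ∈ Bf, ℓ + nbRad (d + 1) L + 1 ≤ torusSupNorm (fun _ : Fin (d + 1) => N) ((fun i => x i / ((L ^ (k + 1) : ℕ) : ℤ)) - cS))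
    {a b : ℝ} (ha : 0 ≤ a) (hb : 0 ≤ b)
    (hsrc : ∀ Y : Site (d + 1) → Fin (d + 1) → Matrix n n ℂ, IsSkewDir Y → IsPeriodicDir Y ((L ^ (k + 1) * N : ℕ) : ℤ) →
      dirIter L (k + 1) (flat (d := d + 1) (n := n)) Y = 0 →
      |hess (flat (d := d + 1) (n := n)) X Y (perWin (d + 1) (L ^ (k + 1) * N))| ≤ a * dirL1 Y Bn + b * dirL1 Y Bf)
    (i i' : n) (xt : Tor (fine (L ^ (k + 1)) (fun _ : Fin (d + 1) => N)) × Fin (d + 1) → ℂ)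
    (hxt : ∀ (μ ν : Fin (d + 1)) (t : Tor (fine (L ^ (k + 1)) (fun _ : Fin (d + 1) => N))),
      Fs (fine (L ^ (k + 1)) (fun _ : Fin (d + 1) => N)) 1 xt μ ν t
        = Fs (fine (L ^ (k + 1)) (fun _ : Fin (d + 1) => N)) 1
            (fun q : Tor (fine (L ^ (k + 1)) (fun _ : Fin (d + 1) => N)) × Fin (d + 1) =>
              X (rep (fine (L ^ (k + 1)) (fun _ : Fin (d + 1) => N)) q.1) q.2 i i') μ ν t)
    (a' : Tor (fine (L ^ (k + 1)) (fun _ : Fin (d + 1) => N)) × Fin (d + 1) → ℂ) (ha' : QvOp (L ^ (k + 1)) (fun _ : Fin (d + 1) => N) *ᵥ a' = 0) :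
    ‖star (CurlOp (fine (L ^ (k + 1)) (fun _ : Fin (d + 1) => N)) ((L ^ (k + 1) : ℕ) : ℂ) *ᵥ a')
        ⬝ᵥ (CurlOp (fine (L ^ (k + 1)) (fun _ : Fin (d + 1) => N)) ((L ^ (k + 1) : ℕ) : ℂ) *ᵥ xt)‖
      ≤ (4 * ((L ^ (k + 1) : ℕ) : ℝ) ^ 2 * (Fintype.card n : ℝ) ^ 2 * (1 + 2 * ((d + 1 : ℕ) : ℝ) * (2 * ((((d + 1 : ℕ) : ℝ)) * L))) * a)
          * ∑ j, ‖a' j‖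
        + (4 * ((L ^ (k + 1) : ℕ) : ℝ) ^ 2 * (Fintype.card n : ℝ) ^ 2 * (1 + 2 * ((d + 1 : ℕ) : ℝ) * (2 * ((((d + 1 : ℕ) : ℝ)) * L))) * b)
          * ∑ j ∈ (Finset.univ : Finset (Tor (fine (L ^ (k + 1)) (fun _ : Fin (d + 1) => N)) × Fin (d + 1))).filter
              (fun j => ℓ ≤ torusSupNorm (fun _ : Fin (d + 1) => N)
                (rep (fun _ : Fin (d + 1) => N) (B5Blocks16.blockOf (L ^ (k + 1)) (fun _ : Fin (d + 1) => N) j.1) - cS)), ‖a' j‖ := by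
  -- the pairing is `2n²·S`
  have hp := curl_pairing_eq (d := d + 1) (L ^ (k + 1) * N) (((L ^ (k + 1) : ℕ) : ℂ)) a' xt
  rw [Finset.sum_congr rfl fun p _ => by rw [hxt]] at hp
  -- real and imaginary parts
  have hre := abs_re_pairing_le_localised hd hL k N hXs hXP cS ℓ Bn Bf hBn hBf hfar ha hb hsrc a' ha' 1 (by simp) i i'
  rw [map_one, one_mul] at hre
  have him := abs_re_pairing_le_localised hd hL k N hXs hXP cS ℓ Bn Bf hBn hBf hfar ha hb hsrc a' ha' Complex.I (by simp) i i'
  rw [show ∀ S : ℂ, (conj Complex.I * S).re = S.im from fun S => by simp [Complex.conj_I]] at him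
  have hSn := (Complex.norm_le_abs_re_add_abs_im _).trans (add_le_add hre him)
  have hA0 : 0 ≤ ∑ j, ‖a' j‖ := Finset.sum_nonneg fun _ _ => norm_nonneg _
  have hB0 : 0 ≤ ∑ j ∈ (Finset.univ : Finset (Tor (fine (L ^ (k + 1)) (fun _ : Fin (d + 1) => N)) × Fin (d + 1))).filter
      (fun j => ℓ ≤ torusSupNorm (fun _ : Fin (d + 1) => N)
        (rep (fun _ : Fin (d + 1) => N) (B5Blocks16.blockOf (L ^ (k + 1)) (fun _ : Fin (d + 1) => N) j.1) - cS)), ‖a' j‖ :=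
    Finset.sum_nonneg fun _ _ => norm_nonneg _
  rw [hp, norm_mul, norm_mul, Complex.norm_ofNat, norm_mul, Complex.norm_conj, Complex.norm_natCast]
  calc 2 * ((((L ^ (k + 1) : ℕ) : ℝ)) * ((L ^ (k + 1) : ℕ) : ℝ)) * _
      ≤ 2 * ((((L ^ (k + 1) : ℕ) : ℝ)) * ((L ^ (k + 1) : ℕ) : ℝ)) * _ := mul_le_mul_of_nonneg_left hSn (by positivity)
    _ = _ := by ring

/-! ## §2 THE END: the localised slice solver letter at the trivial flat datum, `k`-uniform -/

/-- **THE SLICE SOLVER LETTER G♭-loc AT THE TRIVIAL FLAT DATUM, LOCALISED, `k`-UNIFORM** (dimension `d + 1 ≥ 2`, `L ≥ 2`): there are `K ≥ 0` and `c > 0`, depending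
on `d`, `L` and `card n` only, such that for every `k`, `N ≥ 1`, every centre block `y₀` of the coarse torus, every radius `ℓ`, every skew `(L^{k+1}N)`-periodic `X` with
`dirIter L (k+1) 1 X = 0`, every near set `Bn ⊆ [0,L^{k+1}N)^{d+1}`, every far set `Bf ⊆ [0,L^{k+1}N)^{d+1}` whose sites have their block at torus block-distance
`≥ ℓ + nbRad + 1` from `rep y₀`, every `a, b ≥ 0` with `|hess 1 X Y (perWin)| ≤ a·‖Y‖_{1,Bn} + b·‖Y‖_{1,Bf}` for all skew `(L^{k+1}N)`-periodic `Y` with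
`dirIter L (k+1) 1 Y = 0`, and every site `z` whose torus image lies in the block `y₀`: `‖curlAt 1 X z μ ν‖ ≤ K·L^{k+1}·(a + e^{−cℓ}·b)` — the `hGloc` binder of F252 with
`K_G = K·M`, `ϵ = e^{−cℓ}`. [folklore] -/
theorem sliceGreen_flat_localised [Nonempty n] (hd : 1 ≤ d) {L : ℕ} (hL : 2 ≤ L) :
    ∃ K c : ℝ, 0 ≤ K ∧ 0 < c ∧ ∀ (k N : ℕ) [NeZero N] [NeZero (L ^ (k + 1))] (y₀ : Tor (fun _ : Fin (d + 1) => N)) (ℓ : ℝ)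
      (X : Site (d + 1) → Fin (d + 1) → Matrix n n ℂ), IsSkewDir X →
      IsPeriodicDir X ((L ^ (k + 1) * N : ℕ) : ℤ) → dirIter L (k + 1) (flat (d := d + 1) (n := n)) X = 0 →
      ∀ (Bn Bf : Finset (Site (d + 1))), Bn ⊆ periodBox (d := d + 1) (L ^ (k + 1) * N) → Bf ⊆ periodBox (d := d + 1) (L ^ (k + 1) * N) →
      (∀ x ∈ Bf, ℓ + nbRad (d + 1) L + 1
        ≤ torusSupNorm (fun _ : Fin (d + 1) => N) ((fun i => x i / ((L ^ (k + 1) : ℕ) : ℤ)) - rep (fun _ : Fin (d + 1) => N) y₀)) →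
      ∀ a b : ℝ, 0 ≤ a → 0 ≤ b →
      (∀ Y : Site (d + 1) → Fin (d + 1) → Matrix n n ℂ, IsSkewDir Y → IsPeriodicDir Y ((L ^ (k + 1) * N : ℕ) : ℤ) →
        dirIter L (k + 1) (flat (d := d + 1) (n := n)) Y = 0 →
        |hess (flat (d := d + 1) (n := n)) X Y (perWin (d + 1) (L ^ (k + 1) * N))| ≤ a * dirL1 Y Bn + b * dirL1 Y Bf) →
      ∀ (z : Site (d + 1)), B5Blocks16.blockOf (L ^ (k + 1)) (fun _ : Fin (d + 1) => N) (toT (fine (L ^ (k + 1)) (fun _ : Fin (d + 1) => N)) z) = y₀ →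
      ∀ (μ ν : Fin (d + 1)), ‖curlAt (flat (d := d + 1) (n := n)) X z μ ν‖ ≤ K * (L : ℝ) ^ (k + 1) * (a + Real.exp (-(c * ℓ)) * b) := by
  obtain ⟨Ka, Kb, c, hKa, hKb, hc, hcore⟩ := exists_sliceGreen_localised_const (d := d)
  set C₄ : ℝ := 1 + 2 * ((d + 1 : ℕ) : ℝ) * (2 * ((((d + 1 : ℕ) : ℝ)) * L)) with hC₄
  have hC₄0 : 0 ≤ C₄ := by positivity
  refine ⟨4 * (Fintype.card n : ℝ) ^ 3 * C₄ * (Ka + Kb), c, by positivity, hc,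
    fun k N _ _ y₀ ℓ X hXs hXP hXT Bn Bf hBn hBf hfar a b ha hb hsrc z hz μ ν => ?_⟩
  have hL1 : 1 ≤ L := by omega
  haveI : NeZero (L ^ (k + 1) * N) := ⟨Nat.mul_ne_zero (NeZero.ne _) (NeZero.ne N)⟩
  have hnz : ((L ^ (k + 1) : ℕ) : ℂ) ≠ 0 := by exact_mod_cast NeZero.ne (L ^ (k + 1))
  have hcast : ((L ^ (k + 1) : ℕ) : ℝ) = (L : ℝ) ^ (k + 1) := by push_cast; ring
  have hMpos : (0 : ℝ) < ((L ^ (k + 1) : ℕ) : ℝ) := by rw [hcast]; positivity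
  -- `z` read on the fine torus: a point of the block `y₀`
  have hzt : toT (fine (L ^ (k + 1)) (fun _ : Fin (d + 1) => N)) z
      = bpt (L ^ (k + 1)) (fun _ : Fin (d + 1) => N) y₀ (digitOf (L ^ (k + 1)) (fun _ : Fin (d + 1) => N) (toT (fine (L ^ (k + 1)) (fun _ : Fin (d + 1) => N)) z)) := by
    rw [← hz, bpt_blockOf_digitOf]
  -- the far bond set on the torus
  set Sf := (Finset.univ : Finset (Tor (fine (L ^ (k + 1)) (fun _ : Fin (d + 1) => N)) × Fin (d + 1))).filter
    (fun j => ℓ ≤ torusSupNorm (fun _ : Fin (d + 1) => N)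
      (rep (fun _ : Fin (d + 1) => N) (B5Blocks16.blockOf (L ^ (k + 1)) (fun _ : Fin (d + 1) => N) j.1) - rep (fun _ : Fin (d + 1) => N) y₀)) with hSfdef
  have hSf : ∀ j ∈ Sf, ℓ ≤ torusSupNorm (fun _ : Fin (d + 1) => N)
      (rep (fun _ : Fin (d + 1) => N) (B5Blocks16.blockOf (L ^ (k + 1)) (fun _ : Fin (d + 1) => N) j.1) - rep (fun _ : Fin (d + 1) => N) y₀) :=
    fun j hj => (Finset.mem_filter.mp hj).2
  -- the entry bound
  have hentry : ∀ i i' : n, ‖curlAt (flat (d := d + 1) (n := n)) X z μ ν i i'‖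
      ≤ 4 * (Fintype.card n : ℝ) ^ 2 * C₄ * (Ka + Kb) * (L : ℝ) ^ (k + 1) * (a + Real.exp (-(c * ℓ)) * b) := by
    intro i i'
    obtain ⟨xt, hQ, hFs⟩ := exists_kerQ_entry (n := n) hL1 k N hXP hXT i i'
    have hpair := norm_curl_pairing_le_localised hd hL k N hXs hXP (rep (fun _ : Fin (d + 1) => N) y₀) ℓ Bn Bf hBn hBf hfar ha hb hsrc i i' xt hFs
    have hga0 : 0 ≤ 4 * ((L ^ (k + 1) : ℕ) : ℝ) ^ 2 * (Fintype.card n : ℝ) ^ 2 * C₄ * a := by positivity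
    have hgb0 : 0 ≤ 4 * ((L ^ (k + 1) : ℕ) : ℝ) ^ 2 * (Fintype.card n : ℝ) ^ 2 * C₄ * b := by positivity
    have hG1 := hcore (L ^ (k + 1)) (fun _ : Fin (d + 1) => N) xt hQ y₀ ℓ Sf hSf _ _ hga0 hgb0 (fun a'' ha'' => hpair a'' ha'') μ ν
      (digitOf (L ^ (k + 1)) (fun _ : Fin (d + 1) => N) (toT (fine (L ^ (k + 1)) (fun _ : Fin (d + 1) => N)) z))
    rw [← hzt] at hG1
    -- the entry is `n⁻¹·F_n(x̃)`
    have hent : curlAt (flat (d := d + 1) (n := n)) X z μ ν i i'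
        = (((L ^ (k + 1) : ℕ) : ℂ))⁻¹ * Fs (fine (L ^ (k + 1)) (fun _ : Fin (d + 1) => N)) ((L ^ (k + 1) : ℕ) : ℂ) xt μ ν
            (toT (fine (L ^ (k + 1)) (fun _ : Fin (d + 1) => N)) z) := by
      have h1 : curlAt (flat (d := d + 1) (n := n)) X z μ ν i i'
          = Fs (fine (L ^ (k + 1)) (fun _ : Fin (d + 1) => N)) 1
              (fun q : Tor (fine (L ^ (k + 1)) (fun _ : Fin (d + 1) => N)) × Fin (d + 1) =>
                X (rep (fine (L ^ (k + 1)) (fun _ : Fin (d + 1) => N)) q.1) q.2 i i') μ ν (toT (fine (L ^ (k + 1)) (fun _ : Fin (d + 1) => N)) z) :=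
        curlAt_flat_entry_torus (P := L ^ (k + 1) * N) hXP z μ ν i i'
      rw [h1, ← hFs, Fs_eq_mul_Fs_one _ (((L ^ (k + 1) : ℕ) : ℂ)), ← mul_assoc, inv_mul_cancel₀ hnz, one_mul]
    rw [hent, norm_mul, norm_inv, Complex.norm_natCast]
    refine (mul_le_mul_of_nonneg_left hG1 (by positivity)).trans ?_
    -- arithmetic: `M⁻¹·(K_a·g_a + K_b·e^{−cℓ}·g_b) ≤ 4(card n)²C₄(K_a+K_b)·M·(a + e^{−cℓ}b)`
    rw [← hcast]
    have he0 : 0 ≤ Real.exp (-(c * ℓ)) := (Real.exp_pos _).le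
    have hcn : (0 : ℝ) ≤ (Fintype.card n : ℝ) ^ 2 := by positivity
    rw [inv_mul_le_iff₀ hMpos]
    have h1 : Ka * (4 * ((L ^ (k + 1) : ℕ) : ℝ) ^ 2 * (Fintype.card n : ℝ) ^ 2 * C₄ * a)
        ≤ (Ka + Kb) * (4 * ((L ^ (k + 1) : ℕ) : ℝ) ^ 2 * (Fintype.card n : ℝ) ^ 2 * C₄ * a) := by nlinarith
    have h2 : Kb * Real.exp (-(c * ℓ)) * (4 * ((L ^ (k + 1) : ℕ) : ℝ) ^ 2 * (Fintype.card n : ℝ) ^ 2 * C₄ * b)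
        ≤ (Ka + Kb) * Real.exp (-(c * ℓ)) * (4 * ((L ^ (k + 1) : ℕ) : ℝ) ^ 2 * (Fintype.card n : ℝ) ^ 2 * C₄ * b) := by
      have : 0 ≤ Real.exp (-(c * ℓ)) * (4 * ((L ^ (k + 1) : ℕ) : ℝ) ^ 2 * (Fintype.card n : ℝ) ^ 2 * C₄ * b) := by positivity
      nlinarith
    calc Ka * (4 * ((L ^ (k + 1) : ℕ) : ℝ) ^ 2 * (Fintype.card n : ℝ) ^ 2 * C₄ * a)
          + Kb * Real.exp (-(c * ℓ)) * (4 * ((L ^ (k + 1) : ℕ) : ℝ) ^ 2 * (Fintype.card n : ℝ) ^ 2 * C₄ * b)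
        ≤ (Ka + Kb) * (4 * ((L ^ (k + 1) : ℕ) : ℝ) ^ 2 * (Fintype.card n : ℝ) ^ 2 * C₄ * a)
          + (Ka + Kb) * Real.exp (-(c * ℓ)) * (4 * ((L ^ (k + 1) : ℕ) : ℝ) ^ 2 * (Fintype.card n : ℝ) ^ 2 * C₄ * b) := add_le_add h1 h2
      _ = ((L ^ (k + 1) : ℕ) : ℝ) * (4 * (Fintype.card n : ℝ) ^ 2 * C₄ * (Ka + Kb) * ((L ^ (k + 1) : ℕ) : ℝ) * (a + Real.exp (-(c * ℓ)) * b)) := by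
          ring
  -- the operator norm from the entries
  refine (opNorm_le_card_mul _ hentry).trans (le_of_eq ?_)
  ring

end

end Summit.QuantumFields.BalabanUV.T4Continuum.NE7SliceGreenFlatLocalised
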